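import Mathlib
import Literature.LinearAlgebra.Matrix.PermanentLaplace
import Summits.ValiantsHypothesis.ValiantsHypothesis.Theorems.ValuativeGCTValuativeFlipHessenbergCofactors

/-!
# Permanental continuants and path-tridiagonal permanents (crux `ValuativeGCT.ValuativeFlip`,
# stub `stub_fourRowPencilRank`, part P1 of the cyclic-tridiagonal architecture)

Helper file (`--supports stmt-ValiantsHypothesis-12624`).  Part P1 ("cofactor formulas") of the
cyclic-tridiagonal proof architecture for hypothesis `H` of `fourRowPencilRank_of_pencilCertificate`
(`Cruxes/ValuativeFlip/AxisK9G1a2CyclicTridiagonal.md` §1–§2) needs closed forms for the permanental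
cofactors of a cyclic tridiagonal matrix.  This file supplies the OPEN (path) half and the tools:

* `ctK L M M' k` — the permanental continuant (monomer–dimer polynomial) of the path `0, 1, …, k-1`
  with loops `L t`, clockwise edges `M t` (cell `(t, t+1)`) and counter-clockwise edges `M' t` (cell
  `(t, t-1)`): `K₀ = 1`, `K₁ = L 0`, `K_{k+2} = L (k+1) K_{k+1} + M k · M' (k+1) · K_k`;
  `ctK_left` — the left-end recurrence `K_{k+2} = L 0 · K⁺_{k+1} + M 0 · M' 1 · K⁺⁺_k` (shifted data);
* `ctPath L M M' k` — the `k × k` path-tridiagonal matrix `(t,t) ↦ L t`, `(t,t+1) ↦ M t`,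
  `(t+1,t) ↦ M' (t+1)`, and **`ct_permanent_ctPath : per (ctPath L M M' k) = ctK L M M' k`**
  (Laplace along the last row, then along the last column of the off-diagonal minor);
* small permanent tools: lower-triangular permanents (`ct_permanent_of_lowerTriangular`), the easy
  direction of Frobenius–König (`ct_permanent_eq_zero_of_confined`: rows `S` supported inside columns
  `T` with `|T| < |S|` force `per = 0`), and independence of the permanent of a submatrix from the
  enumeration of the kept rows/columns (`ct_permanent_submatrix_eq_of_range_eq`).

[folklore: continuants / monomer–dimer recurrences, Minc 1978 §1]
-/

set_option linter.dupNamespace false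

namespace Summit.ValiantsHypothesis.ValiantsHypothesis.Theorems.ValuativeFlip

open scoped BigOperators Matrix
open Finset

section Continuant

variable {R : Type*} [CommRing R]

/-- The **permanental continuant** of the path `0, …, k-1` with loop weights `L`, clockwise edge
weights `M` (cell `(t,t+1)`) and counter-clockwise edge weights `M'` (cell `(t,t-1)`): the sum over
monomer–dimer configurations of the path of `∏ L(monomers) · ∏ M t M' (t+1)` (dimers `{t,t+1}`),
defined by the right-end recurrence. [folklore] -/
def ctK (L M M' : ℕ → R) : ℕ → R
  | 0 => 1
  | 1 => L 0
  | k + 2 => L (k + 1) * ctK L M M' (k + 1) + M k * M' (k + 1) * ctK L M M' k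

/-- `K₀ = 1`. [folklore] -/
@[simp] theorem ctK_zero (L M M' : ℕ → R) : ctK L M M' 0 = 1 := rfl

/-- `K₁ = L 0`. [folklore] -/
@[simp] theorem ctK_one (L M M' : ℕ → R) : ctK L M M' 1 = L 0 := rfl

/-- Right-end recurrence `K_{k+2} = L (k+1) K_{k+1} + M k · M' (k+1) · K_k`. [folklore] -/
theorem ctK_add_two (L M M' : ℕ → R) (k : ℕ) :
    ctK L M M' (k + 2) = L (k + 1) * ctK L M M' (k + 1) + M k * M' (k + 1) * ctK L M M' k := rfl

/-- `K₂ = L 1 L 0 + M 0 M' 1`. [folklore] -/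
theorem ctK_two (L M M' : ℕ → R) : ctK L M M' 2 = L 1 * L 0 + M 0 * M' 1 := by
  rw [ctK_add_two, ctK_one, ctK_zero, mul_one]

/-- The continuant only depends on the values `L t` (`t < k`), `M t` (`t + 1 < k`), `M' t`
(`1 ≤ t < k`). [folklore] -/
theorem ctK_congr {L₁ M₁ M₁' L₂ M₂ M₂' : ℕ → R} :
    ∀ k : ℕ, (∀ t, t < k → L₁ t = L₂ t) → (∀ t, t + 1 < k → M₁ t = M₂ t) →
      (∀ t, 1 ≤ t → t < k → M₁' t = M₂' t) → ctK L₁ M₁ M₁' k = ctK L₂ M₂ M₂' k := by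
  intro k
  induction k using Nat.strong_induction_on with
  | _ k ih =>
    intro hL hM hM'
    rcases k with _ | _ | k
    · rfl
    · simp [hL 0 (by omega)]
    · rw [ctK_add_two, ctK_add_two, ih (k + 1) (by omega) (fun t ht => hL t (by omega))
        (fun t ht => hM t (by omega)) (fun t h1 ht => hM' t h1 (by omega)),
        ih k (by omega) (fun t ht => hL t (by omega)) (fun t ht => hM t (by omega))
        (fun t h1 ht => hM' t h1 (by omega)), hL (k + 1) (by omega), hM k (by omega),
        hM' (k + 1) (by omega) (by omega)]

/-- **Left-end recurrence** of the continuant: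
`K_{k+2}(data) = L 0 · K_{k+1}(data shifted by 1) + M 0 · M' 1 · K_k(data shifted by 2)`. [folklore] -/
theorem ctK_left (L M M' : ℕ → R) (k : ℕ) :
    ctK L M M' (k + 2) =
      L 0 * ctK (fun t => L (t + 1)) (fun t => M (t + 1)) (fun t => M' (t + 1)) (k + 1) +
        M 0 * M' 1 * ctK (fun t => L (t + 2)) (fun t => M (t + 2)) (fun t => M' (t + 2)) k := by
  induction k using Nat.strong_induction_on with
  | _ k ih =>
    rcases k with _ | _ | k
    · simp only [ctK]
      ring
    · simp only [ctK]
      ring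
    · rw [ctK_add_two, ih (k + 1) (by omega), ih k (by omega)]
      simp only [ctK_add_two]
      ring

end Continuant

section Path

variable {R : Type*} [CommRing R]

/-- The `k × k` **path-tridiagonal matrix**: `(t, t) ↦ L t`, `(t, t+1) ↦ M t`, `(t+1, t) ↦ M' (t+1)`,
all other entries `0`. [folklore] -/
def ctPath (L M M' : ℕ → R) (k : ℕ) : Matrix (Fin k) (Fin k) R := fun x y =>
  if (y : ℕ) = x then L x else if (y : ℕ) = x + 1 then M x else if (x : ℕ) = y + 1 then M' x else 0

/-- Entry formula of `ctPath`. [folklore] -/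
theorem ctPath_apply (L M M' : ℕ → R) (k : ℕ) (x y : Fin k) :
    ctPath L M M' k x y =
      if (y : ℕ) = x then L x else if (y : ℕ) = x + 1 then M x else if (x : ℕ) = y + 1 then M' x else 0 :=
  rfl

/-- Deleting the last row and column of the path matrix gives the shorter path matrix. [folklore] -/
theorem ctPath_submatrix_castSucc (L M M' : ℕ → R) (k : ℕ) :
    (ctPath L M M' (k + 1)).submatrix Fin.castSucc Fin.castSucc = ctPath L M M' k := by
  ext x y
  simp [ctPath_apply]

/-- **Permanent of a path-tridiagonal matrix = permanental continuant.**  Laplace expansion along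
the last row: the diagonal entry leaves the shorter path; the subdiagonal entry `M' (k+1)` leaves a
minor whose last column has the single entry `M k`, in front of the path shortened by two.
[folklore; Minc 1978 §1] -/
theorem ct_permanent_ctPath (L M M' : ℕ → R) : ∀ k : ℕ, (ctPath L M M' k).permanent = ctK L M M' k := by
  intro k
  induction k using Nat.strong_induction_on with
  | _ k ih =>
    rcases k with _ | _ | k
    · exact Matrix.permanent_isEmpty
    · show (ctPath L M M' 1).permanent = ctK L M M' 1
      rw [Matrix.permanent_eq_elem_of_subsingleton _ 0]
      simp [ctPath_apply]
    · -- Laplace along the last row, supported on the last two columns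
      set A := ctPath L M M' (k + 2) with hA
      have hlast : ∀ y : Fin (k + 2), y ∉ ({Fin.castSucc (Fin.last k), Fin.last (k + 1)} : Finset _) →
          A (Fin.last (k + 1)) y = 0 := by
        intro y hy
        simp only [Finset.mem_insert, Finset.mem_singleton, not_or] at hy
        have hy1 : (y : ℕ) ≠ k := fun h => hy.1 (Fin.ext (by simp [h]))
        have hy2 : (y : ℕ) ≠ k + 1 := fun h => hy.2 (Fin.ext (by simp [h]))
        have hyk : (y : ℕ) < k + 2 := y.isLt
        simp only [hA, ctPath_apply, Fin.val_last]
        rw [if_neg (by omega), if_neg (by omega), if_neg (by omega)]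
      rw [Matrix.permanent_eq_sum_row_subset A (Fin.last (k + 1)) _ hlast,
        Finset.sum_pair (by
          intro h
          have := congrArg Fin.val h
          simp at this)]
      -- the two diagonal-type entries
      have e1 : A (Fin.last (k + 1)) (Fin.castSucc (Fin.last k)) = M' (k + 1) := by
        simp only [hA, ctPath_apply, Fin.val_last, Fin.val_castSucc]
        rw [if_neg (by omega), if_neg (by omega), if_pos trivial]
      have e2 : A (Fin.last (k + 1)) (Fin.last (k + 1)) = L (k + 1) := by
        simp only [hA, ctPath_apply, Fin.val_last]
        rw [if_pos trivial]
      -- the diagonal minor is the shorter path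
      have s2 : A.submatrix (Fin.last (k + 1)).succAbove (Fin.last (k + 1)).succAbove =
          ctPath L M M' (k + 1) := by
        rw [Fin.succAbove_last, hA, ctPath_submatrix_castSucc]
      -- the off-diagonal minor: expand along its last column
      set B := A.submatrix (Fin.last (k + 1)).succAbove (Fin.castSucc (Fin.last k)).succAbove with hB
      have hBcol : ∀ x : Fin (k + 1), B x (Fin.last k) = if (x : ℕ) = k then M k else 0 := by
        intro x
        have hx : (x : ℕ) < k + 1 := x.isLt
        have hsa : ((Fin.castSucc (Fin.last k)).succAbove (Fin.last k) : ℕ) = k + 1 := by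
          rw [Fin.succAbove_of_le_castSucc _ _ le_rfl]
          simp
        simp only [hB, Matrix.submatrix_apply, Fin.succAbove_last, hA, ctPath_apply, Fin.val_castSucc,
          hsa]
        by_cases hxk : (x : ℕ) = k
        · rw [if_neg (by omega), if_pos (by omega), if_pos hxk, hxk]
        · rw [if_neg (by omega), if_neg (by omega), if_neg (by omega), if_neg hxk]
      have hBsub : B.submatrix (Fin.last k).succAbove (Fin.last k).succAbove = ctPath L M M' k := by
        ext x y
        have hy : ((Fin.castSucc (Fin.last k)).succAbove (Fin.castSucc y) : ℕ) = y := by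
          rw [Fin.succAbove_of_castSucc_lt _ _ (by
            rw [Fin.castSucc_lt_castSucc_iff]; exact Fin.castSucc_lt_last y)]
          simp
        simp only [hB, Matrix.submatrix_apply, Fin.succAbove_last, hA, ctPath_apply, Fin.val_castSucc, hy]
      have hperB : B.permanent = M k * ctK L M M' k := by
        rw [Matrix.permanent_eq_sum_column B (Fin.last k), Fin.sum_univ_castSucc]
        have hzero : ∑ x : Fin k, B (Fin.castSucc x) (Fin.last k) *
            (B.submatrix (Fin.castSucc x).succAbove (Fin.last k).succAbove).permanent = 0 := by
          refine Finset.sum_eq_zero fun x _ => ?_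
          rw [hBcol, if_neg (by simp; omega), zero_mul]
        rw [hzero, zero_add, hBcol, if_pos (by simp), hBsub, ih k (by omega)]
      rw [e1, e2, s2, ih (k + 1) (by omega), hperB, ctK_add_two]
      ring

end Path

section Tools

variable {R : Type*} [CommRing R]

/-- Permanent of a LOWER triangular matrix = product of the diagonal (transpose of
`hb_permanent_of_upperTriangular`). [folklore] -/
theorem ct_permanent_of_lowerTriangular {k : ℕ} (T : Matrix (Fin k) (Fin k) R)
    (hT : ∀ x y : Fin k, x < y → T x y = 0) : T.permanent = ∏ x, T x x := by
  rw [← Matrix.permanent_transpose, hb_permanent_of_upperTriangular]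
  · rfl
  · intro x y hxy
    exact hT y x hxy

/-- **Frobenius–König, easy direction.**  If the rows in `S` have all their nonzero entries in the
columns `T` and `|T| < |S|`, the permanent vanishes: every permutation sends some column outside `T`
to a row in `S`. [folklore] -/
theorem ct_permanent_eq_zero_of_confined {ι : Type*} [Fintype ι] [DecidableEq ι] (A : Matrix ι ι R)
    (S T : Finset ι) (hST : T.card < S.card) (h : ∀ r ∈ S, ∀ c, c ∉ T → A r c = 0) :
    A.permanent = 0 := by
  unfold Matrix.permanent
  refine Finset.sum_eq_zero fun σ _ => ?_
  have hcard : T.card < (S.image σ.symm).card := by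
    rwa [Finset.card_image_of_injective _ σ.symm.injective]
  obtain ⟨c, hc, hcT⟩ := Finset.exists_mem_notMem_of_card_lt_card hcard
  obtain ⟨r, hr, hrc⟩ := Finset.mem_image.mp hc
  refine Finset.prod_eq_zero (Finset.mem_univ c) ?_
  have hσc : σ c = r := by rw [← hrc]; simp
  rw [hσc]
  exact h r hr c hcT

/-- Two injective enumerations of the same finite set of indices differ by a permutation. [folklore] -/
theorem ct_exists_perm_of_range_eq {k : ℕ} {ι : Type*} (f f' : Fin k → ι) (hf : Function.Injective f)
    (hf' : Function.Injective f') (h : Set.range f = Set.range f') :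
    ∃ σ : Equiv.Perm (Fin k), ∀ x, f' (σ x) = f x := by
  classical
  refine ⟨(Equiv.ofInjective f hf).trans ((Equiv.setCongr h).trans (Equiv.ofInjective f' hf').symm),
    fun x => ?_⟩
  simp only [Equiv.trans_apply]
  rw [Equiv.apply_ofInjective_symm hf']
  rfl

/-- The permanent of a submatrix on `k` rows and `k` columns does not depend on how the kept rows
and columns are enumerated. [folklore] -/
theorem ct_permanent_submatrix_eq_of_range_eq {k : ℕ} {ι : Type*} (A : Matrix ι ι R)
    (f f' g g' : Fin k → ι) (hf : Function.Injective f) (hf' : Function.Injective f')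
    (hff' : Set.range f = Set.range f') (hg : Function.Injective g) (hg' : Function.Injective g')
    (hgg' : Set.range g = Set.range g') :
    (A.submatrix f g).permanent = (A.submatrix f' g').permanent := by
  obtain ⟨σ, hσ⟩ := ct_exists_perm_of_range_eq f f' hf hf' hff'
  obtain ⟨τ, hτ⟩ := ct_exists_perm_of_range_eq g g' hg hg' hgg'
  have h1 : A.submatrix f g = ((A.submatrix f' g').submatrix σ id).submatrix id τ := by
    ext x y
    simp [Matrix.submatrix_apply, hσ, hτ]
  rw [h1, Matrix.permanent_permute_rows, Matrix.permanent_permute_cols]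

end Tools

end Summit.ValiantsHypothesis.ValiantsHypothesis.Theorems.ValuativeFlip
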